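import Literature.NumberTheory.EllipticCurves.KubertTateFiveVeluKernel
import Literature.NumberTheory.EllipticCurves.IsogenyDescentKummerElement
import Literature.NumberTheory.EllipticCurves.X1ElevenMordellWeil
import Literature.NumberTheory.EllipticCurves.MordellWeilModNCard
import HarnessLib

/-!
# The Kubert–Tate curve `E_{13/14} = [1, -182, -2548, 0, 0]`: rational points and `E(ℚ)[25] = ⟨T⟩`

PROOF-ONLY file (theorems; `abbrev`s for the curve over `ℚ` and `ℤ_p`, the embedding `E(ℚ) → E(ℚ̄)`,
and four named rational points), topic `NumberTheory/EllipticCurves`; first half of the `5`-descent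
rank computation completed in `KubertTate1314Rank`. For

  `E = E_{13/14} = kubertTateFive 13 14 : y² + xy - 2548 y = x³ - 182 x²`

(`Δ = -2⁵·7⁵·13⁵·2029`, `T = (0,0)` of order `5`) we prove, unconditionally and without any
`L`-function or local (completion) input:

* `torsionBy_twentyfive_eq` — **`E(ℚ)[25] = E(ℚ)[5] = ⟨T⟩ ≅ ℤ/5`** (reduction modulo `3`:
  `#Ẽ(𝔽₃) ≤ 7`, Silverman VII.3.1, via the tree's `X1Eleven.natCard_le_of_hasNonsingularReduction`);
* `five_nsmul_ne` — a rational point `(x, y)` with `x ∉ {0, 182}` has `5P ∉ {O, T}`;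
* `moduleFinite_point` — Mordell–Weil for `E` in this file's instances (tree
  `module_finite_point_holds`).

The sequel `KubertTate1314Rank` proves `rank E(ℚ) ≥ 2` from these by the `μ₅`-side Kummer argument.

## References

* [SilvermanAEC2009] J. H. Silverman, *AEC*, 2nd ed., VII.3.1, VIII.§1, X.1.1, X.4, Exercise 10.1.
* [Fisher2001FiveSevenDescent] T. Fisher, *Some examples of 5 and 7 descent for elliptic curves over
  ℚ*, JEMS 3 (2001), §1.4: the family `D_λ` of curves with a rational `5`-torsion point, of which
  `E_{13/14}` is the member `λ = 13/14` (the paper does not treat this member; the points `P₁`, `P₂`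
  below are ours, verified in-file).
* [Kubert1976] D. S. Kubert, *Universal bounds on the torsion of elliptic curves*, Table 3.
-/

noncomputable section

open scoped Classical
open WeierstrassCurve Field
open Literature.NumberTheory.EllipticCurves Literature.NumberTheory.EllipticCurves.KubertTateKummer
  Literature.NumberTheory.EllipticCurves.KubertTateVelu

namespace Literature.NumberTheory.EllipticCurves

namespace KubertTate1314Descent

/-! ## Part A. The curve, its rational `5`-torsion, reduction modulo `3` -/

/-- `E = E_{13/14} = kubertTateFive 13 14`. [cite: Kubert1976, Table 3 (N = 5)] -/
abbrev E : WeierstrassCurve ℚ := kubertTateFive 13 14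

/-- The coefficients: `E = [1, -182, -2548, 0, 0]`. [cite: Kubert1976, Table 3 (N = 5)] -/
theorem E_eq : E = ⟨1, -182, -2548, 0, 0⟩ := by
  ext <;> simp [kubertTateFive] <;> norm_num

/-- `Δ(E) = -405171591170528 = -2⁵·7⁵·13⁵·2029`. [cite: Kubert1976, Table 3 (N = 5)] -/
theorem E_Δ : E.Δ = -405171591170528 := by
  rw [kubertTateFive_Δ]; norm_num

/-- `E` is an elliptic curve. [cite: Kubert1976, Table 3 (N = 5)] -/
instance isElliptic_E : E.IsElliptic := ⟨isUnit_iff_ne_zero.mpr (by rw [E_Δ]; norm_num)⟩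

/-- The affine equation of `E`: `y² + xy - 2548y = x³ - 182x²`. [cite: Kubert1976, Table 3 (N = 5)] -/
theorem nonsingular_iff (x y : ℚ) :
    E.toAffine.Nonsingular x y ↔ y ^ 2 + x * y - 2548 * y = x ^ 3 - 182 * x ^ 2 := by
  have hΔ : E.Δ ≠ 0 := by rw [E_Δ]; norm_num
  rw [← Affine.equation_iff_nonsingular_of_Δ_ne_zero hΔ, Affine.equation_iff]
  simp only [kubertTateFive_a₁, kubertTateFive_a₂, kubertTateFive_a₃, kubertTateFive_a₄,
    kubertTateFive_a₆]
  constructor <;> intro h <;> linear_combination h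

/-- `(0,0)`, `(182,2366)`, `(182,0)`, `(-78,936)`, `(98,392)` lie on `E` (checked by `norm_num`; the last
two were found by a naive search). [folklore] -/
private theorem nonsingular_points : E.toAffine.Nonsingular 0 0 ∧ E.toAffine.Nonsingular 182 2366 ∧
    E.toAffine.Nonsingular 182 0 ∧ E.toAffine.Nonsingular (-78) 936 ∧ E.toAffine.Nonsingular 98 392 := by
  refine ⟨(nonsingular_iff _ _).mpr ?_, (nonsingular_iff _ _).mpr ?_, (nonsingular_iff _ _).mpr ?_,
    (nonsingular_iff _ _).mpr ?_, (nonsingular_iff _ _).mpr ?_⟩ <;> norm_num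

/-- `T = (0, 0) ∈ E(ℚ)`. [cite: Kubert1976, Table 3 (N = 5)] -/
def T : E.toAffine.Point := .some 0 0 nonsingular_points.1

/-- `T₂ = (182, 2366) ∈ E(ℚ)` (this is `2T`; the relation is not used). [cite: Kubert1976, Table 3 (N = 5)] -/
def T₂ : E.toAffine.Point := .some 182 2366 nonsingular_points.2.1

/-- `P₁ = (-78, 936) ∈ E(ℚ)` (a point of infinite order found by search; membership is checked in-file).
[folklore] -/
def P₁ : E.toAffine.Point := .some (-78) 936 nonsingular_points.2.2.2.1

/-- `P₂ = (98, 392) ∈ E(ℚ)` (a point of infinite order found by search; membership is checked in-file).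
[folklore] -/
def P₂ : E.toAffine.Point := .some 98 392 nonsingular_points.2.2.2.2

/-- Two affine points with equal coordinates are equal (proof-irrelevant form). [folklore] -/
private theorem some_eq_some_of_eq {R : Type*} [CommRing R] {V : WeierstrassCurve R}
    {x y x' y' : R} (hx : x = x') (hy : y = y') (h : V.toAffine.Nonsingular x y)
    (h' : V.toAffine.Nonsingular x' y') : Affine.Point.some x y h = Affine.Point.some x' y' h' := by
  subst hx hy; rfl

/-- `-T₂ = (182, 0)` (`= 3T`). [cite: Kubert1976, Table 3 (N = 5)] -/
theorem neg_T₂ : -T₂ = .some 182 0 nonsingular_points.2.2.1 := by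
  rw [T₂, Affine.Point.neg_some]
  refine some_eq_some_of_eq rfl ?_ _ _
  rw [Affine.negY]
  simp only [kubertTateFive_a₁, kubertTateFive_a₃]
  norm_num

/-! ### Reduction modulo `3` -/

/-- The `ℤ_p`-integral equation `[1, -182, -2548, 0, 0]`. [cite: Kubert1976, Table 3 (N = 5)] -/
abbrev EInt (p : ℕ) [Fact p.Prime] : WeierstrassCurve ℤ_[p] := ⟨1, -182, -2548, 0, 0⟩

section Padic

variable (p : ℕ) [Fact p.Prime]

/-- `E ⊗ ℚ_p` is the base change of the integral equation. [cite: Kubert1976, Table 3 (N = 5)] -/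
theorem E_baseChange_padic : E.baseChange ℚ_[p] = (EInt p).baseChange ℚ_[p] := by
  rw [E_eq]
  simp only [WeierstrassCurve.baseChange, WeierstrassCurve.map, map_zero, map_one, map_neg,
    map_ofNat]

/-- `Δ = -405171591170528` over `ℤ_p`. [cite: Kubert1976, Table 3 (N = 5)] -/
theorem EInt_Δ : (EInt p).Δ = -405171591170528 := by
  simp only [WeierstrassCurve.Δ, WeierstrassCurve.b₂, WeierstrassCurve.b₄, WeierstrassCurve.b₆,
    WeierstrassCurve.b₈]
  norm_num

/-- `E` has good reduction at `3`: `3 ∤ Δ`. [cite: Kubert1976, Table 3 (N = 5)] -/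
theorem isUnit_Δ_EInt_three : IsUnit (EInt 3).Δ := by
  rw [EInt_Δ, IsUnit.neg_iff, PadicInt.isUnit_iff]
  refine le_antisymm (PadicInt.norm_le_one _) (not_lt.mp fun hlt => ?_)
  have h := (PadicInt.norm_int_lt_one_iff_dvd (p := 3) 405171591170528).mp (by exact_mod_cast hlt)
  norm_num at h

/-- **Finite subgroups of `E(ℚ)` of order prime to `3` have order `≤ 7`** (reduction modulo `3`
is injective on them, Silverman VII.3.1(b), and `#Ẽ(𝔽₃) ≤ 2·3 + 1`; the device of the tree's
`X1Eleven.natCard_le_of_not_dvd`). [cite: SilvermanAEC2009, VII.3 Prop. 3.1(b)] -/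
theorem natCard_le_seven (B : AddSubgroup E.toAffine.Point) [Finite B] (hB : ¬ 3 ∣ Nat.card B) :
    Nat.card B ≤ 7 := by
  haveI : Fact (Nat.Prime 3) := ⟨Nat.prime_three⟩
  have hv := integers_valuationRing_valuation ℤ_[3] ℚ_[3]
  have hW := E_baseChange_padic 3
  set ι : E.toAffine.Point →+ ((EInt 3).baseChange ℚ_[3]).toAffine.Point :=
    (Affine.Point.congrEquiv hW).toAddMonoidHom.comp
      (Affine.Point.map (W' := E.toAffine) (S := ℚ) (Algebra.ofId ℚ ℚ_[3])) with hι
  have hιinj : Function.Injective ι :=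
    (Affine.Point.congrEquiv hW).injective.comp
      (Affine.Point.map_injective (W' := E.toAffine) (f := Algebra.ofId ℚ ℚ_[3]))
  set B' := B.map ι with hB'
  have hcardB' : Nat.card B' = Nat.card B :=
    (Nat.card_congr (B.equivMapOfInjective ι hιinj).toEquiv).symm
  haveI : Finite (IsLocalRing.ResidueField ℤ_[3]) :=
    Finite.of_equiv (ZMod 3) (PadicInt.residueField (p := 3)).symm.toEquiv
  haveI : Fintype (IsLocalRing.ResidueField ℤ_[3]) := Fintype.ofFinite _
  haveI : Finite ((EInt 3).map (IsLocalRing.residue ℤ_[3])).toAffine.Point := finite_point _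
  have hns : ∀ P ∈ B', (EInt 3).HasNonsingularReduction P := fun P _ =>
    hasNonsingularReduction_of_isUnit_Δ hv isUnit_Δ_EInt_three P
  have hkill : ∀ P ∈ B', ((Nat.card B : ℕ) : ℤ) • P = 0 := by
    rintro _ ⟨Q, hQ, rfl⟩
    have h1 : (Nat.card B • (⟨Q, hQ⟩ : B) : B) = 0 := card_nsmul_eq_zero'
    have h2 : Nat.card B • Q = 0 := by
      have h1' := congrArg Subtype.val h1
      rwa [AddSubmonoidClass.coe_nsmul, ZeroMemClass.coe_zero] at h1'
    rw [natCast_zsmul, ← map_nsmul, h2, map_zero]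
  have hn : ValuationRing.valuation ℤ_[3] ℚ_[3] (((Nat.card B : ℕ) : ℤ) : ℚ_[3]) = 1 :=
    X1Eleven.valuation_natCast_eq_one 3 hB
  calc Nat.card B = Nat.card B' := hcardB'.symm
    _ ≤ Nat.card ((EInt 3).map (IsLocalRing.residue ℤ_[3])).toAffine.Point :=
        X1Eleven.natCard_le_of_hasNonsingularReduction hv B' hns hn hkill
    _ ≤ 2 * Fintype.card (IsLocalRing.ResidueField ℤ_[3]) + 1 :=
        natCard_point_le_two_mul_card_add_one' _
    _ = 2 * 3 + 1 := by rw [← Nat.card_eq_fintype_card, natCard_residueField_padicInt]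

end Padic

end KubertTate1314Descent

end Literature.NumberTheory.EllipticCurves

-- The `ℚ`-algebra diamond on `AlgebraicClosure ℚ` (`DivisionRing.toRatAlgebra` vs
-- `AlgebraicClosure.instAlgebra`): `geomPoints`, `geomFunctionField`, the Galois action and the
-- tree's Kummer theory are keyed on the latter (same device as `X1ElevenMordellWeil`).
attribute [-instance] DivisionRing.toRatAlgebra

namespace Literature.NumberTheory.EllipticCurves

namespace KubertTate1314Descent

/-! ### `E(ℚ) → E(ℚ̄)`; the rational `5`-power torsion is `⟨T⟩` -/

/-- `E(ℚ) → E(ℚ̄)` (Mathlib's `Affine.Point.map` along `ℚ → ℚ̄`; pointwise the tree's `toGeomPoints E`,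
spelled with this file's instances, as in `X1ElevenMordellWeil`). [cite: SilvermanAEC2009, VIII.§1] -/
abbrev toGeom : E.toAffine.Point →+ geomPoints E :=
  Affine.Point.map (W' := E.toAffine) (S := ℚ) (Algebra.ofId ℚ (AlgebraicClosure ℚ))

/-- `toGeom` is injective. [cite: SilvermanAEC2009, VIII.§1] -/
theorem toGeom_injective : Function.Injective toGeom :=
  Affine.Point.map_injective (W' := E.toAffine) (f := Algebra.ofId ℚ (AlgebraicClosure ℚ))

/-- Rational points are `Γ_ℚ`-fixed. [cite: SilvermanAEC2009, VIII.§1] -/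
theorem smul_toGeom (σ : absoluteGaloisGroup ℚ) (P : E.toAffine.Point) : σ • toGeom P = toGeom P :=
  smul_toGeomPoints E σ P

/-- `toGeom` on an affine point. [cite: SilvermanAEC2009, VIII.§1] -/
theorem toGeom_some {x y : ℚ} (h : E.toAffine.Nonsingular x y) :
    ∃ h', toGeom (.some x y h) = .some (algebraMap ℚ (AlgebraicClosure ℚ) x)
      (algebraMap ℚ (AlgebraicClosure ℚ) y) h' :=
  ⟨_, Affine.Point.map_some (W' := E.toAffine) (Algebra.ofId ℚ (AlgebraicClosure ℚ)) h⟩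

/-- `toGeom T = T̄ = KubertTateKummer.Tbar 13 14`. [cite: Kubert1976, Table 3 (N = 5)] -/
theorem toGeom_T : toGeom T = Tbar (13 : ℚ) 14 := by
  obtain ⟨h', e⟩ := toGeom_some nonsingular_points.1
  rw [T, e, Tbar_eq]
  exact some_eq_some_of_eq (map_zero _) (map_zero _) _ _

/-- **Mordell–Weil for `E`** (tree theorem `module_finite_point_holds`, stated for the classical
`DecidableEq ℚ` instance of the group law; the instances are subsingletons, `convert` identifies
them). [cite: SilvermanAEC2009, Thm. VIII.6.7] -/
instance moduleFinite_point : Module.Finite ℤ E.toAffine.Point := by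
  convert module_finite_point_holds E

/-- **`T` has order `5` in `E(ℚ)`.** [cite: Kubert1976, Table 3 (N = 5)] -/
theorem addOrderOf_T : addOrderOf T = 5 := by
  rw [← addOrderOf_injective toGeom toGeom_injective T, toGeom_T]
  exact addOrderOf_Tbar (13 : ℚ) 14

/-- `5 T = O`. [cite: Kubert1976, Table 3 (N = 5)] -/
theorem five_nsmul_T : (5 : ℕ) • T = 0 := by
  rw [← addOrderOf_T]; exact addOrderOf_nsmul_eq_zero T

/-- An affine rational point in `⟨T⟩` has `x ∈ {0, 182}`. [cite: Kubert1976, Table 3 (N = 5)] -/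
theorem x_eq_of_mem_zmultiples_T {x y : ℚ} {h : E.toAffine.Nonsingular x y}
    (hP : Affine.Point.some x y h ∈ AddSubgroup.zmultiples T) : x = 0 ∨ x = 182 := by
  obtain ⟨k, hk⟩ := AddSubgroup.mem_zmultiples_iff.mp hP
  have hmem : toGeom (.some x y h) ∈ AddSubgroup.zmultiples (Tbar (13 : ℚ) 14) := by
    rw [← hk, map_zsmul, toGeom_T]
    exact AddSubgroup.zsmul_mem _ (AddSubgroup.mem_zmultiples _) k
  obtain ⟨h', e⟩ := toGeom_some h
  rw [e] at hmem
  rcases eq_zero_or_x_mem_of_mem_zmultiples (13 : ℚ) 14 hmem with h0 | ⟨x', y', h'', hP', hx'⟩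
  · exact absurd h0 (Affine.Point.some_ne_zero _)
  · have hx : algebraMap ℚ (AlgebraicClosure ℚ) x = x' := by injection hP'
    rcases hx' with rfl | rfl
    · exact Or.inl ((map_eq_zero_iff _ (algebraMap ℚ (AlgebraicClosure ℚ)).injective).mp hx)
    · right
      have := (algebraMap ℚ (AlgebraicClosure ℚ)).injective hx
      linarith

/-- **The rational `25`-torsion of `E` is `⟨T⟩`** (it is a `5`-group of order prime to `3`, so of
order `≤ 7` by reduction modulo `3`, and it contains `⟨T⟩` of order `5`).
[cite: SilvermanAEC2009, VII.3 Prop. 3.1(b)] -/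
theorem torsionBy_twentyfive_eq :
    AddSubgroup.torsionBy E.toAffine.Point ((25 : ℕ) : ℤ) = AddSubgroup.zmultiples T := by
  set B := AddSubgroup.torsionBy E.toAffine.Point ((25 : ℕ) : ℤ) with hB
  -- `B` is finite (Mordell–Weil)
  haveI : Finite B := finite_torsionBy_of_moduleFinite E.toAffine.Point 25
  -- `3 ∤ #B`
  have h3 : ¬ 3 ∣ Nat.card B := by
    intro h3
    haveI : Fact (Nat.Prime 3) := ⟨Nat.prime_three⟩
    obtain ⟨g, hg⟩ := exists_prime_addOrderOf_dvd_card' 3 h3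
    have hg25 : (25 : ℕ) • (g : E.toAffine.Point) = 0 := AddSubgroup.torsionBy.nsmul_iff.mp g.2
    have hdvd : addOrderOf (g : E.toAffine.Point) ∣ 25 := addOrderOf_dvd_of_nsmul_eq_zero hg25
    rw [AddSubgroup.addOrderOf_coe, hg] at hdvd
    norm_num at hdvd
  have h7 := natCard_le_seven B h3
  -- `⟨T⟩ ≤ B`, `#⟨T⟩ = 5`
  have hle : AddSubgroup.zmultiples T ≤ B := by
    rw [AddSubgroup.zmultiples_le, hB]
    apply AddSubgroup.torsionBy.nsmul_iff.mpr
    rw [show (25 : ℕ) = 5 * 5 from rfl, mul_nsmul, five_nsmul_T, nsmul_zero]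
  have hT5 : Nat.card (AddSubgroup.zmultiples T) = 5 := by rw [Nat.card_zmultiples, addOrderOf_T]
  have hdvd : 5 ∣ Nat.card B := hT5 ▸ AddSubgroup.card_dvd_of_le hle
  refine (AddSubgroup.eq_of_le_of_card_ge hle ?_).symm
  rw [hT5]
  obtain ⟨c, hc⟩ := hdvd
  rw [hc] at h7 h3 ⊢
  have hc2 : c < 2 := by omega
  interval_cases c <;> omega

/-- The rational `5`-torsion is `⟨T⟩`, of order `5`: `#E(ℚ)[5] = 5`. [cite: Kubert1976, Table 3 (N = 5)] -/
theorem natCard_torsionBy_five :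
    Nat.card (AddSubgroup.torsionBy E.toAffine.Point ((5 : ℕ) : ℤ)) = 5 := by
  have h : AddSubgroup.torsionBy E.toAffine.Point ((5 : ℕ) : ℤ) = AddSubgroup.zmultiples T := by
    refine le_antisymm ?_ ?_
    · rw [← torsionBy_twentyfive_eq]
      intro P hP
      have hP' : (5 : ℕ) • P = 0 := AddSubgroup.torsionBy.nsmul_iff.mp hP
      apply AddSubgroup.torsionBy.nsmul_iff.mpr
      rw [show (25 : ℕ) = 5 * 5 from rfl, mul_nsmul, hP', nsmul_zero]
    · rw [AddSubgroup.zmultiples_le]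
      exact AddSubgroup.torsionBy.nsmul_iff.mpr five_nsmul_T
  rw [h, Nat.card_zmultiples, addOrderOf_T]

/-- A rational point `P = (x, y)` with `x ∉ {0, 182}` has `5P ≠ O` and `5P ≠ T`.
[cite: SilvermanAEC2009, VII.3 Prop. 3.1(b)] -/
theorem five_nsmul_ne {x y : ℚ} {h : E.toAffine.Nonsingular x y} (hx0 : x ≠ 0) (hx : x ≠ 182) :
    (5 : ℕ) • Affine.Point.some x y h ≠ 0 ∧ (5 : ℕ) • Affine.Point.some x y h ≠ T := by
  have hnot : Affine.Point.some x y h ∉ AddSubgroup.zmultiples T := fun hm ↦ by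
    rcases x_eq_of_mem_zmultiples_T hm with h0 | h182
    · exact hx0 h0
    · exact hx h182
  rw [← torsionBy_twentyfive_eq] at hnot
  have hnot' : ¬ (5 : ℕ) • ((5 : ℕ) • Affine.Point.some x y h) = 0 := fun h' ↦
    hnot (AddSubgroup.torsionBy.nsmul_iff.mpr (by rw [show (25 : ℕ) = 5 * 5 from rfl, mul_nsmul, h']))
  refine ⟨fun h0 ↦ hnot' (by rw [h0, nsmul_zero]), fun hT ↦ hnot' (by rw [hT, five_nsmul_T])⟩

end KubertTate1314Descent

end Literature.NumberTheory.EllipticCurves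

end
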